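import Summits.AnomalousDissipation.AnomalousDissipation.Theorems.MirrorEnsembleMirrorStatisticsLoudTGStubEulerCoerciveKTools
import Summits.AnomalousDissipation.AnomalousDissipation.Theorems.MirrorEnsembleMirrorStatisticsLoudTGStubTubeProfilesK
import Summits.AnomalousDissipation.AnomalousDissipation.Theorems.MirrorEnsembleMirrorStatisticsLoudTGStubOddPoincareK
import Summits.AnomalousDissipation.AnomalousDissipation.Theorems.MirrorEnsembleMirrorStatisticsLoudTGStubTubeLawSmoothK
import Summits.AnomalousDissipation.AnomalousDissipation.Theorems.MirrorEnsembleMirrorStatisticsLoudTGStubTubeLawTransferK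
import HarnessLib

/-!
# The statistical Kelvin tube law (edge-cusp law) for mirror-supported Euler statistics of the
# Taylor–Green force — line `regimes`, crux `MirrorEnsemble.MirrorStatisticsLoudTG` (stmt-AnomalousDissipation-17693)

THEOREM (`stub_skeletonCuspLawK`, registered stub of the line, sorry-free here). There are `c, δ₁ > 0` such that
for every tube width `0 < δ ≤ δ₁`, every stationary statistical solution `μ` of the Euler equations forced by
`f_TG` (FMRT class, `ν = 0`) that is carried by the closed mirror class `Fix K`, and every majorant `Λ` of the local
enstrophy `∫_{N_δ} ∑ⱼ ‖∂ⱼv‖²` on the skeleton tube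
`N_δ = {‖x₂‖ ≤ δ} ∩ ({‖x₀‖ ≤ 2δ} ∪ {‖x₀ − ½‖ ≤ 2δ} ∪ {‖x₁‖ ≤ 2δ} ∪ {‖x₁ − ½‖ ≤ 2δ})`
(a `δ`-neighbourhood, of volume `O(δ²)`, of the symmetry lines of the Taylor–Green cell in the plane `x₂ = 0`,
containing the skeleton loop `C = ∂([0,½]² × {x₂ = 0})`), one has

  `c · δ ≤ ∫ Λ dμ`.

So every such statistics carries an EDGE CUSP of enstrophy on the skeleton (mean enstrophy density `≳ dist(·, C)⁻¹`);
in particular none is carried by fields whose gradients are uniformly in `L^{2p}`, `p > 2`, near `C` (there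
`∫_{N_δ} |∇v|² = O(δ^{2 − 2/p}) = o(δ)`), which covers Dirac masses at `C¹` mirror-symmetric steady Euler states
(the statistical form of Kelvin's circulation obstruction `∮_C f_TG · dl = 4/π ≠ 0`, cf. PumpedMirror's
`NoSmoothMirrorDodgerTG`). What is NOT excluded — the open stub `stub_noCuspK` of the line — are cusped statistics
saturating the law.

PROOF = composition of the landed stubs of the line: the tube current `g` of `C` with `(f_TG, g) ≥ 1`
(`stub_tubeProfilesK`), the deterministic tube inequality `|∫ ⟪∇g v, v⟫| ≤ K A³ δ⁻¹ ∫_{N_δ} |∇v|²` for smooth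
exactly K-symmetric solenoidal fields (`stub_tubeLawSmoothK` over the local Poincaré lemma `stub_oddPoincareK`),
its transfer to finite-enstrophy mirror classes (`stub_tubeLawTransferK`), and the mean Reynolds-stress balance of
Euler statistics on `Fix K` (`skeletonLaw_of_tubeInequality`): `1 ≤ (f_TG, g) ≤ (K A³/δ) ∫ Λ dμ`.

References: M. E. Brachet, D. I. Meiron, S. A. Orszag, B. G. Nickel, R. H. Morf, U. Frisch, *Small-scale structure
of the Taylor–Green vortex*, J. Fluid Mech. 130 (1983) 411–452, §2 (symmetries, the impermeable box)
[doi:10.1017/s0022112083001159]; C. Foias, O. Manley, R. Rosa, R. Temam, *Navier–Stokes Equations and Turbulence*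
(CUP 2001), Ch. IV §1.2 Def. 1.3 [FMRTTurbulence2001]; W. Thomson (Kelvin), circulation theorem (1869) [folklore].
-/

-- every `Summit.AnomalousDissipation.AnomalousDissipation.…` name repeats the summit = problem segment (tree layout)
set_option linter.dupNamespace false

noncomputable section

namespace Summit.AnomalousDissipation.AnomalousDissipation.Theorems.MirrorEnsembleMirrorStatisticsLoudTG

open MeasureTheory Filter Topology
open scoped ENNReal InnerProductSpace NNReal
open Literature.Analysis.FunctionSpaces Literature.Analysis.FluidPDE
open Summit.AnomalousDissipation.AnomalousDissipation.Theorems.TaylorGreenLoudGalerkinStates.Negative (tgForce)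
open Summit.AnomalousDissipation.AnomalousDissipation.Theorems.MirrorStatisticsLoudTG.Negative (mirrorClass)

/-- Local notation: the energy space `H` of `T³`. -/
local notation "H3" => Torus.energySpace (Fin 3)

/-- **The statistical Kelvin tube law (edge-cusp law)** for mirror-supported stationary statistical solutions of the
Euler equations forced by `f_TG`: with constants `c, δ₁ > 0`, for every `0 < δ ≤ δ₁`, every such statistics `μ` and
every majorant `Λ` of the tube enstrophy `∫_{N_δ} ∑ⱼ ‖wⱼ‖²` (`wⱼ` the `L²` weak partial derivatives) on
`Fix K ∩ {finite enstrophy}`, `c δ ≤ ∫ Λ dμ`. Registered stub `stub_skeletonCuspLawK` of line `regimes`; proved from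
the landed `stub_tubeProfilesK`, `stub_tubeLawSmoothK stub_oddPoincareK`, `stub_tubeLawTransferK` and
`skeletonLaw_of_tubeInequality` (`c = 1/(K A³)`). [folklore] -/
theorem stub_skeletonCuspLawK :
    ∃ c δ₁ : ℝ, 0 < c ∧ 0 < δ₁ ∧ ∀ δ : ℝ, 0 < δ → δ ≤ δ₁ →
      ∀ μ : Measure H3, μ (closure mirrorClass)ᶜ = 0 → Torus.IsStationaryStatisticalSolution 0 tgForce μ →
        ∀ Λ : H3 → ℝ≥0∞,
          (∀ v : H3, v ∈ mirrorClass →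
            Torus.eGradNormSq ((v : Lp (EuclideanSpace ℝ (Fin 3)) 2 (volume : Measure (UnitAddTorus (Fin 3)))) :
              UnitAddTorus (Fin 3) → EuclideanSpace ℝ (Fin 3)) ≠ ⊤ →
            ∀ w : Fin 3 → UnitAddTorus (Fin 3) → EuclideanSpace ℝ (Fin 3),
              (∀ j, Torus.HasWeakPartialDeriv j
                ((v : Lp (EuclideanSpace ℝ (Fin 3)) 2 (volume : Measure (UnitAddTorus (Fin 3)))) :
                  UnitAddTorus (Fin 3) → EuclideanSpace ℝ (Fin 3)) (w j)) →
              (∀ j, MemLp (w j) 2 volume) →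
              ∫⁻ x in {x : UnitAddTorus (Fin 3) | ‖x 2‖ ≤ δ ∧ (‖x 0‖ ≤ 2 * δ ∨
                  ‖x 0 - ((2⁻¹ : ℝ) : UnitAddCircle)‖ ≤ 2 * δ ∨ ‖x 1‖ ≤ 2 * δ ∨ ‖x 1 - ((2⁻¹ : ℝ) : UnitAddCircle)‖ ≤ 2 * δ)},
                ∑ j, ‖w j x‖ₑ ^ 2 ≤ Λ v) →
          ENNReal.ofReal (c * δ) ≤ ∫⁻ v, Λ v ∂μ := by
  obtain ⟨A, δ₁, hA, hδ₁, hδ₁le, hprof⟩ := stub_tubeProfilesK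
  obtain ⟨K, hK0, htube⟩ := stub_tubeLawSmoothK stub_oddPoincareK
  set C : ℝ := K * A ^ 3 with hC
  have hCpos : 0 < C := by positivity
  refine ⟨1 / C, δ₁, by positivity, hδ₁, fun δ hδ hδle μ hKμ hμ Λ hΛ => ?_⟩
  have hδ16 : δ ≤ 16⁻¹ := hδle.trans hδ₁le
  obtain ⟨ρ, η, hρs, hηs, hρp, hηp, hηb, hρb, hρ'b, hηsupp, hρ'supp, hgs, hgd, hgz, hfg⟩ := hprof δ hδ hδle
  -- the smooth tube inequality for the tube current of these profiles, and its transfer to `Fix K ∩ {G < ∞}`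
  have hsmooth := htube A δ ρ η hA hδ hδ16 hρs hηs hρp hηp hηb hρb hρ'b hηsupp hρ'supp
  have htrans := stub_tubeLawTransferK C δ _ hCpos.le hδ hgs hsmooth
  -- the statistical skeleton law with `Λ' = (C/δ) Λ`
  have key := skeletonLaw_of_tubeInequality _ (fun v => ENNReal.ofReal (C / δ) * Λ v) hgs hgd hgz
    (fun v hv hfin => htrans v hv hfin (Λ v) (fun w hw hw2 => hΛ v hv hfin w hw hw2)) μ hKμ hμ
  rw [lintegral_const_mul' _ _ ENNReal.ofReal_ne_top] at key
  -- `1 ≤ (f_TG, g) ≤ (C/δ) ∫ Λ`, hence `δ/C ≤ ∫ Λ`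
  have h1 : ENNReal.ofReal 1 ≤ ENNReal.ofReal (C / δ) * ∫⁻ v, Λ v ∂μ :=
    (ENNReal.ofReal_le_ofReal hfg).trans key
  have hcd : ENNReal.ofReal (1 / C * δ) = ENNReal.ofReal (δ / C) := by
    congr 1; ring
  rw [hcd]
  by_cases hX : ∫⁻ v, Λ v ∂μ = ⊤
  · rw [hX]; exact le_top
  · -- finite case: move to `ℝ`
    set X := ∫⁻ v, Λ v ∂μ with hXdef
    have hXr : X = ENNReal.ofReal X.toReal := (ENNReal.ofReal_toReal hX).symm
    rw [hXr] at h1 ⊢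
    rw [← ENNReal.ofReal_mul (by positivity)] at h1
    have h2 : (1 : ℝ) ≤ C / δ * X.toReal := by
      have := (ENNReal.ofReal_le_ofReal_iff (by positivity)).1 h1
      linarith
    refine ENNReal.ofReal_le_ofReal ?_
    rw [div_le_iff₀ hCpos]
    have h3 : C / δ * X.toReal * δ = X.toReal * C := by
      field_simp
    nlinarith [h2, hδ, h3, mul_le_mul_of_nonneg_right h2 hδ.le]

end Summit.AnomalousDissipation.AnomalousDissipation.Theorems.MirrorEnsembleMirrorStatisticsLoudTG

end
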